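import Summits.CriticalPhenomena.PercolationContinuityZ3.Theorems.Transplant.SkelFrmBParamsFaceFloorsPinSYA
import Summits.CriticalPhenomena.PercolationContinuityZ3.Theorems.Transplant.SkelFrmBParamsFaceFloorsLAdYA
import Summits.CriticalPhenomena.PercolationContinuityZ3.Theorems.Transplant.SkelFrmBParamsFaceOriginsYLA
import Summits.CriticalPhenomena.PercolationContinuityZ3.Theorems.Transplant.SkelFrmBParamsFaceOriginsXA
import Summits.CriticalPhenomena.PercolationContinuityZ3.Theorems.Transplant.SkelFrmBParamsFaceOriginsYA
import Summits.CriticalPhenomena.PercolationContinuityZ3.Theorems.Transplant.SkelFrmBParamsFramesF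
import Summits.CriticalPhenomena.PercolationContinuityZ3.Theorems.Transplant.SkelFrmBParamsFaceFloorsClrYF
import Summits.CriticalPhenomena.PercolationContinuityZ3.Theorems.Transplant.SkelFrmBParamsFaceFloorsClrYA
import Summits.CriticalPhenomena.PercolationContinuityZ3.Theorems.Transplant.SkelFrmBParamsFaceFloorsFAYA
import Summits.CriticalPhenomena.PercolationContinuityZ3.Theorems.Transplant.SkelFrmBParamsFaceFloorsFBYA
import Summits.CriticalPhenomena.PercolationContinuityZ3.Theorems.Transplant.SkelFrmBParamsFaceFloorsFTYA
import Summits.CriticalPhenomena.PercolationContinuityZ3.Theorems.Transplant.SkelFrmBParamsFaceFloorsLYA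
import Summits.CriticalPhenomena.PercolationContinuityZ3.Theorems.Transplant.SkelFrmBParamsFaceFloorsQYA
import Summits.CriticalPhenomena.PercolationContinuityZ3.Theorems.Transplant.SkelFrmBParamsFaceFloorsZPiYA
import Summits.CriticalPhenomena.PercolationContinuityZ3.Theorems.Transplant.SkelFrmBParamsFaceFloorsZYA
import Summits.CriticalPhenomena.PercolationContinuityZ3.Theorems.Transplant.SkelFrmBParamsFaceFloorsPinYA
import Summits.CriticalPhenomena.PercolationContinuityZ3.Theorems.Transplant.SkelFrmBParamsFaceCountsYA
import Summits.CriticalPhenomena.PercolationContinuityZ3.Theorems.Transplant.SkelFrmBParamsFaceCountsRangeYA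
import Summits.CriticalPhenomena.PercolationContinuityZ3.Theorems.Transplant.SkelFrmBParamsFaceCountsShiftYA
import Summits.CriticalPhenomena.PercolationContinuityZ3.Theorems.Transplant.SkelPhiFaceNumsYP2T
import Summits.CriticalPhenomena.PercolationContinuityZ3.Theorems.Transplant.SkelFrmBChoiceWindow
import Summits.CriticalPhenomena.PercolationContinuityZ3.Theorems.Transplant.PlanarSkeletonFrmDefs
import Summits.CriticalPhenomena.PercolationContinuityZ3.Theorems.Transplant.SkelPhiStepIDataNS
import Summits.CriticalPhenomena.PercolationContinuityZ3.Theorems.Transplant.SkelFrmBParamsFaceFloorsY2SA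
import Summits.CriticalPhenomena.PercolationContinuityZ3.Theorems.Transplant.SkelFrmBParamsFaceFloorsY2WA
import Summits.CriticalPhenomena.PercolationContinuityZ3.Theorems.Transplant.SkelFrmBParamsFaceFloorsYxA
import HarnessLib
/-!
# N2 (frames-only node, OPEN) — (F) column, (R-49)(c2b) VALUE LAYER part B: **THE PREFIX x-RUN's FLOORS OF THE X4-SHAPED y′-FACE ROUTE**
# (hp-8 g43; the twin of `KS.floorsFT_YW` with the x-run FIRST, from the x-face origin, `N_x` regions, phase window `qBXFs = R'0`)

`KS.floorsFX_Yx`: the six rows `FX1–FX6` of `Skelφ.FloorsYx2V` (SkelPhiFaceNumsYxP2V) at an origin `yL` with `|F1cA yL| ≤ 2u₁` (the x-face origin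
`yLXFs σ` has it, `abs_F1cA_le_of_Λ₁ ∘ Λ_yLXFs`) and count `KS.NxW` (≤ `240·Kq + 9`, `NxW_range`), one-sided (`sgOf du = 1`, the served steps): the
LEVEL rows from `FT1_YA/FT2_YA` directly at the origin (the prefix stays at the contact's level: `flo + 5u₁ + 1 ≤ F1cA yL ≤ fhi − 5u₁ − 1` from
`|F1cA yL| ≤ 2u₁`, the band `faceL 1 j ± E`, `E ≤ 2R'0`, `6R'0 + 11 ≤ u₁`, `u₁(j+1) ≤ r₁`), the α rows from `FT5_YA/FT6_YA` (stated at the one-stride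
window `qB3YA`) by monotonicity in the phase window (`xSLo` is antitone, `xSHi` monotone in `q`; `R'0 ≤ qB3YA`) and the positions hypothesis `htan`
(`KS.tanYx_pos`, part B2). The `σ = −1` rows are vacuous one-sided.
NON-VACUITY: instantiated by part C at the node tuple. builds on p205010 (kernel theorem, internal audit signed; external expert review pending) —
nothing here uses p205010; NOTHING is claimed about the open node `SamePDropOfSkeletonFrm₁`.
Lane `prim-bschramm`, seat `prim-hp-8` (gen 43); helper file (`--supports stmt-CriticalPhenomena-4575 --as helper`).
[cite: KozmaNitzan2024, §4 Lemma 11–12 (pp. 21–25)] [cite: MartineauTassion2017, §4.3]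
-/

noncomputable section

open scoped Classical

namespace Summit.CriticalPhenomena.PercolationContinuityZ3.Theorems.Transplant

namespace PlanarSkeletonFrm

namespace NegB

open Literature.Probability.Percolation Literature.Probability.LatticeModels SimpleGraph KNCells KNLevels
open Literature.Probability.Percolation.KozmaNitzan.Cells (oth sgOf sgOf_sign stepVec_apply_fst)
open SkelConc (Consts)
open Skelφ (shearUnit shearUnit_pos yBoxLoS yBoxHiS ySLo ySHi yBnd xBoxB xSLo xSHi xBoxLoA xBoxHiA crossOffY yPrmW xCoreB xCSLo xCSHi)
open Skelφ.StepI (DataN)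
open ChainPlanar (BridgePrm)
open TwoAxis.Para (modulus)
open Neg

namespace KS

set_option maxHeartbeats 1000000 in
/-- **The prefix x-run's six floors** (`FX1–FX6` of `FloorsYx2V` at origin `yL`, count `NxW`, window `qBXFs`), one-sided. [cite: KozmaNitzan2024, §4 Lemma 12 (pp. 23–25)] -/
theorem floorsFX_Yx (κ : Consts) {V : Type} [DecidableEq V] [Countable V] {G : SimpleGraph V} [G.LocallyFinite] (Φ : PlanarSkeletonFrm G) (t : V) (p : unitInterval) (D : Skelφ.StepI.DataNS V) (g : ℕ) (f : ℕ) (mk : ℕ) (P : PCells2T) (hP : P.toPCells2 = fcellsA κ Φ t p D g f) (hN : EqNumL κ Φ t p D g f) (hκ : (hL κ Φ t p D g f).natAbs ≤ 10 * nL κ Φ t p D g f)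
    (hnA : 2000 * Neg.Kq κ * (KS0.R'0 κ Φ t p D mk + 2) ≤ nL κ Φ t p D g f) (hℓ : 22000 * Neg.Kq κ * (KS0.R'0 κ Φ t p D mk + 2) ≤ ℓL κ Φ t p D g f)
    (hs1 : 6 * (KS0.R'0 κ Φ t p D mk : ℤ) + 11 ≤ u₁A κ Φ t p D g f)
    (x : Site 2) (du : MDir) (j : ℕ) (hj : j < P.K) (z : Site 2) {E : ℕ}
    (hlev1 : P.faceL 1 j - E ≤ P.lev du x z)
    (hlev2 : P.lev du x z ≤ P.faceL 1 j + E) (hE2 : (E : ℤ) ≤ 2 * (KS0.R'0 κ Φ t p D mk : ℤ))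
    (yL : Site 2) (he1 : |F1cA κ Φ t p D g f yL| ≤ 2 * u₁A κ Φ t p D g f)
    (hsg : sgOf du = 1) (hNx : NxW κ Φ t p D g f P yL x du z (bwY κ Φ t p D g f) + 1 ≤ 240 * Neg.Kq κ + 10)
    (htan : ∀ k ≤ NxW κ Φ t p D g f P yL x du z (bwY κ Φ t p D g f),
      -(5 * (P.r 0 : ℤ) - 4 - 3 - P.c 1 - |z 0 - P.cenS x 0|) + 10 * u₀A κ Φ t p D g f + 2 ≤ FcA κ Φ t p D g f yL + 1 * u₀A κ Φ t p D g f * (k : ℤ) ∧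
        FcA κ Φ t p D g f yL + 1 * u₀A κ Φ t p D g f * (k : ℤ) + 10 * u₀A κ Φ t p D g f + 2 ≤ 5 * (P.r 0 : ℤ) - 4 - 3 - P.c 1 - |z 0 - P.cenS x 0|) :
    (sgOf du = 1 → ∀ k ≤ NxW κ Φ t p D g f P yL x du z (bwY κ Φ t p D g f),
      modulus (nL κ Φ t p D g f) (hL κ Φ t p D g f) (vL κ Φ t p D g f) (vβL κ Φ t p D g f) *
          ((5 * (P.r 1 : ℤ) + 10 * u₁A κ Φ t p D g f * (j : ℤ) + 3 - P.lev du x z) -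
            F1cA κ Φ t p D g f yL) ≤
        -(u₁A κ Φ t p D g f * (shearUnit (nL κ Φ t p D g f) (hL κ Φ t p D g f) : ℤ) *
            (xBoxB (nL κ Φ t p D g f) (ℓL κ Φ t p D g f) (hL κ Φ t p D g f) (KS0.R'0 κ Φ t p D mk) k + 1)) -
          modulus (nL κ Φ t p D g f) (hL κ Φ t p D g f) (vL κ Φ t p D g f) (vβL κ Φ t p D g f) + 1) ∧
    (sgOf du = 1 → ∀ k ≤ NxW κ Φ t p D g f P yL x du z (bwY κ Φ t p D g f),
      modulus (nL κ Φ t p D g f) (hL κ Φ t p D g f) (vL κ Φ t p D g f) (vβL κ Φ t p D g f) *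
            (F1cA κ Φ t p D g f yL + 1) +
          u₁A κ Φ t p D g f * ((shearUnit (nL κ Φ t p D g f) (hL κ Φ t p D g f) : ℤ) *
              xBoxB (nL κ Φ t p D g f) (ℓL κ Φ t p D g f) (hL κ Φ t p D g f) (KS0.R'0 κ Φ t p D mk) k + shearUnit (nL κ Φ t p D g f) (hL κ Φ t p D g f) - 1) ≤
        modulus (nL κ Φ t p D g f) (hL κ Φ t p D g f) (vL κ Φ t p D g f) (vβL κ Φ t p D g f) * (25 * (P.r 1 : ℤ) - 2 - P.lev du x z)) ∧
    (sgOf du = -1 → ∀ k ≤ NxW κ Φ t p D g f P yL x du z (bwY κ Φ t p D g f),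
      modulus (nL κ Φ t p D g f) (hL κ Φ t p D g f) (vL κ Φ t p D g f) (vβL κ Φ t p D g f) *
          ((5 * (P.r 1 : ℤ) + 10 * u₁A κ Φ t p D g f * (j : ℤ) + 3 - P.lev du x z) +
            F1cA κ Φ t p D g f yL + 1) ≤
        -(u₁A κ Φ t p D g f * ((shearUnit (nL κ Φ t p D g f) (hL κ Φ t p D g f) : ℤ) *
            xBoxB (nL κ Φ t p D g f) (ℓL κ Φ t p D g f) (hL κ Φ t p D g f) (KS0.R'0 κ Φ t p D mk) k + shearUnit (nL κ Φ t p D g f) (hL κ Φ t p D g f) - 1))) ∧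
    (sgOf du = -1 → ∀ k ≤ NxW κ Φ t p D g f P yL x du z (bwY κ Φ t p D g f),
      -(modulus (nL κ Φ t p D g f) (hL κ Φ t p D g f) (vL κ Φ t p D g f) (vβL κ Φ t p D g f) *
              F1cA κ Φ t p D g f yL) +
            u₁A κ Φ t p D g f * (shearUnit (nL κ Φ t p D g f) (hL κ Φ t p D g f) : ℤ) *
              (xBoxB (nL κ Φ t p D g f) (ℓL κ Φ t p D g f) (hL κ Φ t p D g f) (KS0.R'0 κ Φ t p D mk) k + 1) +
          modulus (nL κ Φ t p D g f) (hL κ Φ t p D g f) (vL κ Φ t p D g f) (vβL κ Φ t p D g f) - 1 ≤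
        modulus (nL κ Φ t p D g f) (hL κ Φ t p D g f) (vL κ Φ t p D g f) (vβL κ Φ t p D g f) * (25 * (P.r 1 : ℤ) - 2 - P.lev du x z)) ∧
    (∀ k ≤ NxW κ Φ t p D g f P yL x du z (bwY κ Φ t p D g f),
      (nL κ Φ t p D g f : ℤ) * modulus (nL κ Φ t p D g f) (hL κ Φ t p D g f) (vL κ Φ t p D g f) (vβL κ Φ t p D g f) *
          (-(5 * (P.r 0 : ℤ) - 4 - 3 - P.c 1 - |z 0 - P.cenS x 0|) -
            FcA κ Φ t p D g f yL) ≤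
        u₀A κ Φ t p D g f * modulus (nL κ Φ t p D g f) (hL κ Φ t p D g f) (vL κ Φ t p D g f) (vβL κ Φ t p D g f) *
              xSLo (nL κ Φ t p D g f) (qBXFs κ Φ t p D mk) (KS0.R'0 κ Φ t p D mk) (sgOf du) k -
            u₀A κ Φ t p D g f * (nL κ Φ t p D g f : ℤ) * (shearUnit (nL κ Φ t p D g f) (hL κ Φ t p D g f) : ℤ) *
              (xBoxB (nL κ Φ t p D g f) (ℓL κ Φ t p D g f) (hL κ Φ t p D g f) (KS0.R'0 κ Φ t p D mk) k + 1) -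
          u₀A κ Φ t p D g f * (nL κ Φ t p D g f : ℤ) -
          (nL κ Φ t p D g f : ℤ) * modulus (nL κ Φ t p D g f) (hL κ Φ t p D g f) (vL κ Φ t p D g f) (vβL κ Φ t p D g f)) ∧
    (∀ k ≤ NxW κ Φ t p D g f P yL x du z (bwY κ Φ t p D g f),
      (nL κ Φ t p D g f : ℤ) * modulus (nL κ Φ t p D g f) (hL κ Φ t p D g f) (vL κ Φ t p D g f) (vβL κ Φ t p D g f) *
            (FcA κ Φ t p D g f yL + 1) +
            u₀A κ Φ t p D g f * modulus (nL κ Φ t p D g f) (hL κ Φ t p D g f) (vL κ Φ t p D g f) (vβL κ Φ t p D g f) *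
              xSHi (nL κ Φ t p D g f) (qBXFs κ Φ t p D mk) (KS0.R'0 κ Φ t p D mk) (sgOf du) k +
          u₀A κ Φ t p D g f * (nL κ Φ t p D g f : ℤ) * (shearUnit (nL κ Φ t p D g f) (hL κ Φ t p D g f) : ℤ) *
            (xBoxB (nL κ Φ t p D g f) (ℓL κ Φ t p D g f) (hL κ Φ t p D g f) (KS0.R'0 κ Φ t p D mk) k + 1) ≤
        (nL κ Φ t p D g f : ℤ) * modulus (nL κ Φ t p D g f) (hL κ Φ t p D g f) (vL κ Φ t p D g f) (vβL κ Φ t p D g f) *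
          (5 * (P.r 0 : ℤ) - 4 - 3 - P.c 1 - |z 0 - P.cenS x 0|)) := by
  have hu1 : 1 ≤ u₁A κ Φ t p D g f := (units_eqA κ Φ t p D g f).2.2.2.2.2
  have hr1 : (P.r 1 : ℤ) = 40 * (Neg.Kq κ : ℤ) * u₁A κ Φ t p D g f := by rw [(cells_of_hP κ Φ t p D g f P hP).1 1]; exact (units_eqA κ Φ t p D g f).2.2.2.1
  have hKq' : (1 : ℤ) ≤ (Neg.Kq κ : ℤ) := by exact_mod_cast Neg.one_le_Kq κ
  have hR0 : (0 : ℤ) ≤ (KS0.R'0 κ Φ t p D mk : ℤ) := by positivity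
  obtain ⟨hfl, hjr⟩ := faceL1_eq κ Φ t p D g f P hP j hj
  have hlev_lo : 5 * (P.r 1 : ℤ) + 10 * u₁A κ Φ t p D g f * ((j : ℤ) + 1) - 1 - E ≤ P.lev du x z := by rw [← hfl]; exact hlev1
  have hlev_hi : P.lev du x z ≤ 5 * (P.r 1 : ℤ) + 10 * u₁A κ Φ t p D g f * ((j : ℤ) + 1) - 1 + E := by rw [← hfl]; exact hlev2
  have hKu : u₁A κ Φ t p D g f ≤ (Neg.Kq κ : ℤ) * u₁A κ Φ t p D g f := le_mul_of_one_le_left (by linarith) hKq'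
  have hk3 : ∀ k ≤ NxW κ Φ t p D g f P yL x du z (bwY κ Φ t p D g f), k + 1 ≤ 1000 * Neg.Kq κ := fun k hk => by
    have := Neg.one_le_Kq κ; omega
  obtain ⟨e1, e2⟩ := abs_le.1 he1
  have hm1 : sgOf du ≠ -1 := by rw [hsg]; norm_num
  refine ⟨fun _ k hk => ?_, fun _ k hk => ?_, fun h => absurd h hm1, fun h => absurd h hm1, fun k hk => ?_, fun k hk => ?_⟩
  · have hnear : 5 * (P.r 1 : ℤ) + 10 * u₁A κ Φ t p D g f * (j : ℤ) + 3 - P.lev du x z + 5 * u₁A κ Φ t p D g f + 1 ≤ F1cA κ Φ t p D g f yL := by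
      linarith
    exact FT1_YA κ Φ t p D g f P mk hN hκ hℓ _ (hk3 k hk) hnear
  · have hfar : F1cA κ Φ t p D g f yL + 5 * u₁A κ Φ t p D g f + 1 ≤ 25 * (P.r 1 : ℤ) - 2 - P.lev du x z := by
      linarith
    exact FT2_YA κ Φ t p D g f P mk hN hκ hℓ _ (hk3 k hk) hfar
  · have h := FT5_YA κ Φ t p D g f P 1 mk hN hκ hnA hℓ yL x z 0 (sgOf_sign du) (hk3 k hk) (by rw [hsg]; exact (htan k hk).1)
    -- the first run's phase window is `qBXFs = R'0 ≤ qB3YA`: the α-floor only improves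
    refine le_trans h ?_
    have hq : (qBXFs κ Φ t p D mk : ℤ) ≤ (qB3YA κ Φ t p D g f (KS0.R'0 κ Φ t p D mk) : ℤ) := by
      unfold qBXFs qB3YA; push_cast; nlinarith
    have hmono : xSLo (nL κ Φ t p D g f) (qB3YA κ Φ t p D g f (KS0.R'0 κ Φ t p D mk)) (KS0.R'0 κ Φ t p D mk) (sgOf du) k ≤
        xSLo (nL κ Φ t p D g f) (qBXFs κ Φ t p D mk) (KS0.R'0 κ Φ t p D mk) (sgOf du) k := by
      have hk0 : (0 : ℤ) ≤ (k : ℤ) := by positivity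
      have hq0 : (0 : ℤ) ≤ (qBXFs κ Φ t p D mk : ℤ) := by positivity
      have hn0 : (0 : ℤ) ≤ (nL κ Φ t p D g f : ℤ) := by positivity
      unfold xSLo xBoxLoA xBoxHiA; rw [hsg]; simp only [one_mul]
      rw [min_eq_left (by nlinarith), min_eq_left (by nlinarith)]; linarith
    have hum : 0 ≤ u₀A κ Φ t p D g f * modulus (nL κ Φ t p D g f) (hL κ Φ t p D g f) (vL κ Φ t p D g f) (vβL κ Φ t p D g f) := by
      obtain ⟨hn1, hℓ1⟩ := one_le_of_eqNumL κ Φ t p D g f hN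
      exact mul_nonneg (by linarith [(units_eqA κ Φ t p D g f).2.2.2.2.1]) (Skelφ.NegPrm.modulus_vβOf_pos hn1 hℓ1 _ _).le
    have hx := mul_le_mul_of_nonneg_left hmono hum
    linarith only [hx]
  · have h := FT6_YA κ Φ t p D g f P 1 mk hN hκ hnA hℓ yL x z 0 (sgOf_sign du) (hk3 k hk) (by rw [hsg]; exact (htan k hk).2)
    refine le_trans ?_ h
    have hq : (qBXFs κ Φ t p D mk : ℤ) ≤ (qB3YA κ Φ t p D g f (KS0.R'0 κ Φ t p D mk) : ℤ) := by
      unfold qBXFs qB3YA; push_cast; nlinarith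
    have hmono : xSHi (nL κ Φ t p D g f) (qBXFs κ Φ t p D mk) (KS0.R'0 κ Φ t p D mk) (sgOf du) k ≤
        xSHi (nL κ Φ t p D g f) (qB3YA κ Φ t p D g f (KS0.R'0 κ Φ t p D mk)) (KS0.R'0 κ Φ t p D mk) (sgOf du) k := by
      have hk0 : (0 : ℤ) ≤ (k : ℤ) := by positivity
      have hq0 : (0 : ℤ) ≤ (qBXFs κ Φ t p D mk : ℤ) := by positivity
      have hn0 : (0 : ℤ) ≤ (nL κ Φ t p D g f : ℤ) := by positivity
      unfold xSHi xBoxLoA xBoxHiA; rw [hsg]; simp only [one_mul]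
      rw [max_eq_right (by nlinarith), max_eq_right (by nlinarith)]; linarith
    have hum : 0 ≤ u₀A κ Φ t p D g f * modulus (nL κ Φ t p D g f) (hL κ Φ t p D g f) (vL κ Φ t p D g f) (vβL κ Φ t p D g f) := by
      obtain ⟨hn1, hℓ1⟩ := one_le_of_eqNumL κ Φ t p D g f hN
      exact mul_nonneg (by linarith [(units_eqA κ Φ t p D g f).2.2.2.2.1]) (Skelφ.NegPrm.modulus_vβOf_pos hn1 hℓ1 _ _).le
    have hx := mul_le_mul_of_nonneg_left hmono hum
    linarith only [hx]


/-- **The prefix's nominal positions stay inside the transverse room** (the `htan` input of `floorsFX_Yx`): for `k ≤ N_x`, `FcA yL + u₀·k` lies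
between `−fw + 10u₀ + 2` and `fw − 10u₀ − 2` (`fw = 5r₀ − 7 − c₁ − |z₀ − cen₀|`), from the corrector's budget at the virtual junction
(`Skelφ.mul_fwdCount_lt` at the prefix's start reading `yTX0 yL σ`: the strides stop one past the window's near edge `T0Y − bw`), the step `|FcA (yTX0 yL σ) − FcA yL| ≤ u₀ + 2`, `|FcA yL| ≤ 5u₀`,
`|T0Y| ≤ |z₀ − cen₀| + c₁` and the band row `2kE + 24u₀ + 24 + 2c₁ ≤ 5r₀` (also for the `NX0 = 6` forced strides). [folklore] -/
theorem tanYx_pos (κ : Consts) {V : Type} [DecidableEq V] [Countable V] {G : SimpleGraph V} [G.LocallyFinite] (Φ : PlanarSkeletonFrm G) (t : V) (p : unitInterval) (D : Skelφ.StepI.DataNS V) (g : ℕ) (f : ℕ) (P : PCells2T) (x : Site 2) (du : MDir) (hd : du.1 = 1) (z yL : Site 2) {kE : ℤ} (hz : |z 0 - P.cenS x 0| ≤ kE)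
    (hkE24 : 2 * kE + 24 * u₀A κ Φ t p D g f + 24 + 2 * (P.c 1 : ℤ) ≤ 5 * (P.r 0 : ℤ)) (hu : 1 ≤ u₀A κ Φ t p D g f)
    (he : |FcA κ Φ t p D g f yL| ≤ 5 * u₀A κ Φ t p D g f) (hN : EqNumL κ Φ t p D g f) (bw : ℕ) :
    ∀ k ≤ NxW κ Φ t p D g f P yL x du z bw,
      -(5 * (P.r 0 : ℤ) - 4 - 3 - P.c 1 - |z 0 - P.cenS x 0|) + 10 * u₀A κ Φ t p D g f + 2 ≤ FcA κ Φ t p D g f yL + 1 * u₀A κ Φ t p D g f * (k : ℤ) ∧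
        FcA κ Φ t p D g f yL + 1 * u₀A κ Φ t p D g f * (k : ℤ) + 10 * u₀A κ Φ t p D g f + 2 ≤ 5 * (P.r 0 : ℤ) - 4 - 3 - P.c 1 - |z 0 - P.cenS x 0| := by
  intro k hk
  set u := u₀A κ Φ t p D g f with hu_def
  set yTv := yTX0 κ Φ t p D g f yL (sgOf du) with hyTv
  have hdv : |FcA κ Φ t p D g f yTv - FcA κ Φ t p D g f yL| ≤ u₀A κ Φ t p D g f + 2 := FcA_yTX0_sub_abs_le κ Φ t p D g f hN yL (sgOf_sign du)
  have hun : ((u.toNat : ℕ) : ℤ) = u := Int.toNat_of_nonneg (by linarith)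
  have hu0 : 0 < u.toNat := by omega
  have up := Skelφ.mul_fwdCount_lt (T := T0Y P x du z) (F := FcA κ Φ t p D g f yTv + u) (bw := bw) hu0
  rw [hun] at up
  have hN : (N3WY κ Φ t p D g f P yTv x du z bw : ℤ) = (Skelφ.fwdCount (T0Y P x du z) (FcA κ Φ t p D g f yTv + u) u.toNat bw : ℤ) := rfl
  have hkmax : k ≤ NX0 ∨ k ≤ N3WY κ Φ t p D g f P yTv x du z bw := le_max_iff.1 hk
  have hc0 : (0 : ℤ) ≤ P.c 1 := P.c_nonneg 1
  have hσ1 : |sgOf du| = 1 := by rcases sgOf_sign du with h | h <;> simp [h]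
  have hTle' : |T0Y P x du z| ≤ |z 0 - P.cenS x 0| + P.c 1 := by
    have e : T0Y P x du z = -(z 0 - P.cenS x 0) + sgOf du * P.c 1 := by unfold T0Y; rw [cenS_step_zero P x du hd]; ring
    rw [e]
    calc |-(z 0 - P.cenS x 0) + sgOf du * P.c 1| ≤ |-(z 0 - P.cenS x 0)| + |sgOf du * P.c 1| := abs_add_le _ _
      _ = |z 0 - P.cenS x 0| + P.c 1 := by rw [abs_neg, abs_mul, hσ1, one_mul, abs_of_nonneg hc0]
  have ha0 : 0 ≤ |z 0 - P.cenS x 0| := abs_nonneg _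
  obtain ⟨e1, e2⟩ := abs_le.1 he
  obtain ⟨d1, d2⟩ := abs_le.1 hdv
  obtain ⟨t1, t2⟩ := abs_le.1 hTle'
  have hbw0 : (0 : ℤ) ≤ bw := Nat.cast_nonneg _
  have hk0 : (0 : ℤ) ≤ u * (k : ℤ) := mul_nonneg (by linarith) (by positivity)
  rcases hkmax with h5 | hkN
  · -- the forced strides: position within `6u₀` of the origin
    have hk5 : (k : ℤ) ≤ 6 := by unfold NX0 at h5; exact_mod_cast h5
    have hk5' : u * (k : ℤ) ≤ u * 6 := mul_le_mul_of_nonneg_left hk5 (by linarith)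
    constructor <;> linarith
  · -- the corrector's strides: bounded by the budget at the virtual junction
    have hk' : (k : ℤ) ≤ (N3WY κ Φ t p D g f P yTv x du z bw : ℤ) := by exact_mod_cast hkN
    rw [hN] at hk'
    generalize (Skelφ.fwdCount (T0Y P x du z) (FcA κ Φ t p D g f yTv + u) u.toNat bw : ℤ) = N at up hk'
    have hku : u * (k : ℤ) ≤ u * N := mul_le_mul_of_nonneg_left hk' (by linarith)
    rcases le_max_iff.1 up with h | h
    · constructor <;> linarith
    · constructor <;> linarith

end KS

end NegB

end PlanarSkeletonFrm

end Summit.CriticalPhenomena.PercolationContinuityZ3.Theorems.Transplant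

end
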